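import Summits.BirchSwinnertonDyer.BirchSwinnertonDyer.Theorems.PrintCFramJZeroThreeTraceFormBadPrimes
import Summits.BirchSwinnertonDyer.BirchSwinnertonDyer.Theorems.PrintCFramJZeroThreeUnitRegimePsi5K11
import Summits.BirchSwinnertonDyer.Rank1Residual.X12.JZeroThreeUnitRegime
import Literature.NumberTheory.QuadraticFields.KroneckerSplitting
import HarnessLib

/-! # K12r@3 — the «3-unit regime» CLASS THEOREM for `(d, d_K) = (5, −11)`: BSD(W, 3) for every
# globally minimal `W ≅ y² = x³ + 5·m²` of analytic rank one whose bad primes are `3` and `5`,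
# from Kriz–Li Thm. 1.20 + Rem. 3.10 (ROUTE U at `p = 3`) with the ψ-, K-, Bernoulli- and trace-form
# binders DISCHARGED in the kernel (cell `bsd-print-cfram`, seat p3 g1; crux C1
# `CMRamifiedThreeBSD`, stmt-BirchSwinnertonDyer-20371; classes `225a, 675a, 6075a, 6075b, 6075c`)

HONEST FRAMING (cell `bsd-print-cfram`, run/shared/lean/pub/bsd-print-cfram/, D-0131 (2) print
tier; verbatim in every file of the cell): the cell works the partition leaf
`CornerF ∧ p ramified in the CM field K` (LADDER-BSD row K7r = B13; W-ALL row 12r) in PARTITION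
currency — a leaf or a cell counts only when its theorem is in the kernel BY NAME. Nothing here is a
Literature statement, no named fact is introduced, nothing is asserted about BSD; beyond-print: NO
(Kriz–Li 2019 §10.3's mechanism; `225a` is Kriz–Li Thm. 1.23's `E_5`, the others are outside the
printed `E_d` family but inside Thm. 1.20's reach — P3-UNIT-REGIME-CENSUS).

`bsdp_three_of_unitRegime_five_eleven` = seat p4's `JZeroThree.bsdp_three_of_thm120_unitRegime`
(ROUTE U: Kriz–Li Thm. 1.20 `hKL` ∧ Rem. 3.10 `hRem` + Gross–Zagier + Kolyvagin + GZK + modularity +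
the twin's `3`-part + descent inputs, at `p = 3`, `j = 0`) with, for `ψ = (·/5)`, `K = ℚ(√−11)`,
`ε_K = (·/11)`, EVERY character-theoretic binder discharged: `hψ` (primitive), `hss` (the trace
form — `PrintCFram.hss_three_of_mordell_int`, p542185/p544703), (1) `h1a`/`h1b`, (3) `h3` (bad primes
`⊂ {3, 5}`), `hsplit`/`hHN` (`3`, `5` split in `ℚ(√−11)`), `hμ`/`hd4`, `hεK`
(`isKroneckerCharacterOf_eleven`), `hB` (the two kernel certificates of
`PrintCFramJZeroThreeUnitRegimePsi5K11`). What REMAINS displayed is exactly Route U's non-character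
telescope: the Heegner/parametrisation DATA `(D, H, ι, ιp, P, hP)` and the PUB facts
(`hGZ`, `hKo`, `hGZK`, `hmod`), `r_an = 1`, `L(W^{(−11)}, 1) ≠ 0`, the twin `Wd` with its `3`-part
`htw` (Burungale–Flach for the CM twin, the caller's) and `htam`/`hu`, the certificate binders `htamW`
(`3 ∤ ∏c_ℓ`), `hSW`/`hSd` (`3 ∤ #Ш`, the two-engine 3-descents), the level-`0` generator `g`
(`hg0`, `hiv`, `crd`), and three one-line facts about the model: `hW` (`C • W = y² = x³ + 5m²`,
`5m²` sixth-power-free: `h6`), `h2` (`a₂(W) = 0`; here `2 ∤ N`, so a kernel point count), `hS` (every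
bad prime is `3` or `5`: `ℓ ∣ Δ_min`). PER CLASS in its binders, nothing booked; a display record in the
regime has NO transcendental input (`#Ш_an` is not a binder).
References: [KrizLi2019] Thm. 1.20 (pp. 7–8), Rem. 3.10 (p. 26), Thm. 1.23, §10.3;
[GrossZagier1986] V.§2; [Miller2011LMS] Def. 1.1; `X12/JZeroThreeUnitRegime.lean` (p4),
`X12/O11/RouteUMember11.lean` (bsd-cm, the `p = 7` pattern).
-/

set_option linter.dupNamespace false
set_option autoImplicit false

noncomputable section

open scoped Classical
open NumberField Field WeierstrassCurve DirichletCharacter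
open Literature.NumberTheory.EllipticCurves Literature.NumberTheory.EllipticCurves.KrizLi2019
  Literature.NumberTheory.EllipticCurves.ModularForms Literature.NumberTheory.QuadraticFields
  Summit.BirchSwinnertonDyer.Rank1Residual.X12.O11.RouteU

namespace Summit.BirchSwinnertonDyer.BirchSwinnertonDyer.Theorems.PrintCFram

/-- `(−11/3) = 1` (`−11 ≡ 1 = 1² (mod 3)`). [folklore] -/
theorem legendreSym_three_neg_eleven : legendreSym 3 (-11) = 1 := by
  rw [legendreSym_eq_ite 3 (by norm_num)]; decide

/-- `(−11/5) = 1` (`−11 ≡ 4 = 2² (mod 5)`). [folklore] -/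
theorem legendreSym_five_neg_eleven : legendreSym 5 (-11) = 1 := by
  rw [legendreSym_eq_ite 5 (by norm_num)]; decide

/-- **`3` and `5` split in an imaginary quadratic field of discriminant `−11`.**
[cite: KrizLi2019, Thm. 1.20 (p. 7, "p splits in K") and §1.4 (Heegner hypothesis)] -/
theorem ncard_primesOver_eq_two_of_discr_eq_neg_eleven {K : Type} [Field K] [NumberField K]
    (hK : IsImaginaryQuadratic K) (hd : NumberField.discr K = -11) {p : ℕ} (hp : p = 3 ∨ p = 5) :
    ((Ideal.span {(p : ℤ)}).primesOver (𝓞 K)).ncard = 2 := by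
  rcases hp with rfl | rfl
  · rw [Quadratic.ncard_primesOver_eq_two_iff_legendreSym hK.1 (by norm_num), hd]
    exact legendreSym_three_neg_eleven
  · rw [Quadratic.ncard_primesOver_eq_two_iff_legendreSym hK.1 (by norm_num), hd]
    exact legendreSym_five_neg_eleven

/-- **BSD(W, 3) in the 3-UNIT REGIME for `(d, d_K) = (5, −11)`** — for every globally minimal `W/ℚ`
of analytic rank one with `C • W = y² = x³ + 5·m²` (`m ∈ ℤ`, `5m²` sixth-power-free), bad primes
`⊂ {3, 5}`, `a₂(W) = 0` if `W` is good at `2`, and an imaginary quadratic `K` with `d_K = −11`: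
ROUTE U at `p = 3` (`JZeroThree.bsdp_three_of_thm120_unitRegime`, p4) with `ψ = (·/5)`,
`ε_K = (·/11)↑` and every character / trace-form / splitting / Bernoulli binder discharged by this
cell's kernel files; the displayed binders are Route U's data, PUB facts and certificates (module
docstring). [cite: KrizLi2019, Thm. 1.20 (pp. 7–8), Rem. 3.10 (p. 26), §10.3]
[cite: GrossZagier1986, V.§2 (pp. 310–312)] [cite: Miller2011LMS, Def. 1.1] -/
theorem bsdp_three_of_unitRegime_five_eleven
    (hKL : KrizLi2019.thm120_padicLogHeegner_unit_of_bernoulli)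
    (hRem : KrizLi2019.rem310_padicLogHeegner_integral)
    (W : WeierstrassCurve ℚ) [W.IsElliptic] [W.IsGloballyMinimal] [NeZero (W.conductorNorm ℤ)]
    -- the Mordell datum and the three per-curve one-liners
    {m : ℤ} (hm : m ≠ 0) (hW : ∃ C : VariableChange ℚ, C • W = mordellCurve ((5 : ℤ) * (m : ℚ) ^ 2))
    (h6 : ∀ ℓ : ℕ, ℓ.Prime → ¬ ((ℓ : ℤ) ^ 6 ∣ 5 * m ^ 2))
    (h2 : (haveI : Fact (Nat.Prime 2) := ⟨Nat.prime_two⟩; W.HasGoodReductionAtPrime 2) →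
      W.LFunction 2 = 0)
    (hS : ∀ ℓ : ℕ, (hℓ : ℓ.Prime) → ¬ (haveI := Fact.mk hℓ; W.HasGoodReductionAtPrime ℓ) →
      ℓ = 3 ∨ ℓ = 5)
    -- the Heegner field `ℚ(√−11)` and Route U's data / PUB facts
    (K : Type) [Field K] [NumberField K] [NeZero (NumberField.discr K).natAbs]
    (hK : IsImaginaryQuadratic K) (hdK : NumberField.discr K = -11)
    (D : ModularParametrizationData W (W.conductorNorm ℤ))
    (H : HeegnerDatum (W.conductorNorm ℤ) (NumberField.discr K)) (ι : K →+* ℂ)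
    (ιp : K →+* ℚ_[3]) (P : (W.baseChange K).toAffine.Point)
    (hGZ : gross_zagier (W.conductorNorm ℤ) W K) (hKo : kolyvagin (W.conductorNorm ℤ) W K)
    (hGZK : rank_eq_analyticRank_of_analyticRank_le_one) (hmod : hasEntireLFunction_rat)
    (hP : WeierstrassCurve.Affine.Point.map ι.toRatAlgHom P = heegnerPointComplex D H)
    (hr : W.analyticRank = 1)
    (hLt : (W.quadraticTwist (NumberField.discr K : ℚ)).entireLFunction 1 ≠ 0)
    (Wd : WeierstrassCurve ℚ) [Wd.IsElliptic] [Wd.IsGloballyMinimal] (Cd : VariableChange ℚ)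
    (hWd : Cd • W.quadraticTwist (NumberField.discr K : ℚ) = Wd)
    (htw : ∃ q : ℚ, Wd.entireLFunction 1 / (Wd.realPeriodRat : ℂ) = (q : ℂ) ∧
      padicValRat 3 q = (padicValNat 3 Wd.shaOrder : ℤ) + padicValNat 3 Wd.tamagawaProduct -
        2 * padicValNat 3 Wd.torsionOrder)
    (htam : padicValNat 3 Wd.tamagawaProduct = padicValNat 3 W.tamagawaProduct)
    (hu : padicValRat 3 (Cd.u : ℚ) = 0)
    (htamW : ¬ 3 ∣ W.tamagawaProduct)
    (hSW : ∀ [Finite W.sha], ¬ 3 ∣ W.shaOrder) (hSd : ∀ [Finite Wd.sha], ¬ 3 ∣ Wd.shaOrder)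
    -- a Teichmüller character mod 3 and T-U2's level-0 generator data
    (ω : DirichletCharacter ℚ_[3] 3) (hω : KrizLi2019.IsTeichmullerCharacter ω)
    [Finite (AddCommGroup.torsion (W.baseChange K).toAffine.Point)]
    (crd : (W.baseChange K).toAffine.Point →+ ℤ) (g : (W.baseChange K).toAffine.Point)
    (hg : crd g = 1) (hker : ∀ x, crd x = 0 → IsOfFinAddOrder x)
    (hiv : ∀ x : (W.baseChange K).toAffine.Point, 3 • x = 0 → x = 0)
    (hg0 : ‖Castella2018.padicLogOmega W 3 ιp g‖ = 1) :
    BSDp W 3 := by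
  -- the characters `ψ = (·/5)`, `ε = (·/11)`, `ε_K = ε↑`
  obtain ⟨χ₅, h₅⟩ := exists_legendreCharacter_three 5
  obtain ⟨χ₁₁, h₁₁⟩ := exists_legendreCharacter_three 11
  have h11 : 11 ∣ (NumberField.discr K).natAbs := by rw [hdK]; decide
  have hne5 : χ₅ ≠ 1 := legendreChar_three_ne_one χ₅ h₅ (by norm_num)
  have hωne : ω ≠ 1 := ne_one_of_isTeichmullerCharacter (p := 3) (by norm_num) hω
  -- `j(W) = 0`
  have hj : W.j = 0 := by
    obtain ⟨C, hC⟩ := hW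
    have hc4 : (C • W).c₄ = 0 := by rw [hC, mordellCurve_c₄]
    have h1 : (C • W).j = W.j := variableChange_j W C
    have h2' : (C • W).j = 0 := by rw [WeierstrassCurve.j, hc4]; simp
    rw [← h1, h2']
  -- the Mordell datum in the `(d, m)` currency of the trace-form files
  have hW' : ∃ C : VariableChange ℚ, C • W = mordellCurve (((5 : ℤ) : ℚ) * (m : ℚ) ^ 2) := by
    simpa using hW
  have hsf : Squarefree (5 : ℤ) := by
    rw [show (5 : ℤ) = ((5 : ℕ) : ℤ) by rfl, Int.squarefree_natCast]
    exact Nat.prime_five.squarefree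
  -- `hss`
  have hss := hss_three_of_mordell_int W hsf hm hW' h6 h2 χ₅ ω hω
    (legendreChar_three_mul_self χ₅ h₅) (fun ℓ hℓ _ h1 => by
      have := legendreChar_three_apply_prime_eq_jacobiSym χ₅ h₅ (by norm_num) hℓ (by omega)
      simpa using this)
  -- the Heegner hypothesis: every bad prime is `3` or `5`, both split in `ℚ(√−11)`
  have hHN : SatisfiesHeegnerHypothesis (W.conductorNorm ℤ) K := by
    intro p hp hpN
    haveI := Fact.mk hp
    refine ncard_primesOver_eq_two_of_discr_eq_neg_eleven hK hdK (hS p hp fun hgood => ?_)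
    exact not_dvd_conductorNorm_of_hasGoodReductionAtPrime W hgood hpN
  refine Rank1Residual.X12.JZeroThree.bsdp_three_of_thm120_unitRegime hKL hRem W hj K D H ι ιp P hGZ
    hKo hGZK hmod hK (by rw [hdK]; norm_num) hHN hP hr hLt Wd Cd hWd htw htam hu htamW hSW hSd 5 χ₅ ω
    (legendreChar_three_isPrimitive χ₅ h₅ (by norm_num)) hω hss
    (legendreChar_three_apply_three_ne_one χ₅ h₅ (by rw [legendreSym_eq_ite 5 (by norm_num)]; decide))
    (primVal_invMulOmega_ne_one_of_prime_level (by norm_num) χ₅ hne5 ω hωne (Or.inr (dvd_refl 3)))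
    (fun ℓ hℓ hℓ3 hbad => ?_) (changeLevel h11 χ₁₁) (isKroneckerCharacterOf_eleven hK.1 hdK χ₁₁ h₁₁ h11)
    (bernoulli_hypothesis_five_eleven h11 χ₅ h₅ χ₁₁ h₁₁ ω hω) crd g hg hker hiv hg0
  -- (3) at the additive primes `ℓ ≠ 3`: `ℓ = 5`, where both characters vanish
  have hℓ5 : ℓ = 5 := by
    rcases hS ℓ hℓ hbad.1 with h | h
    · exact absurd h hℓ3
    · exact h
  subst hℓ5
  exact ⟨legendreChar_three_apply_ne_one_of_dvd χ₅ h₅ (dvd_refl 5),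
    primVal_invMulOmega_ne_one_of_prime_level (by norm_num) χ₅ hne5 ω hωne (Or.inl (dvd_refl 5))⟩

end Summit.BirchSwinnertonDyer.BirchSwinnertonDyer.Theorems.PrintCFram

end
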